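import Summits.Langlands.Langlands.Theorems.IrreducibilityBySelfDualityHeckeEigenvalueFieldStubConeEquivariant
import HarnessLib

/-!
# `GL_n(K)`-equivariance of the cone form with the sign-twisted archimedean coefficient action —
# crux HeckeEigenvalueField (stmt-Langlands-13632), line Sketch, stub `stub_coneForm_equivariant_full`

Statement.  Let `K` be a number field, `K_∞ = mixedSpace K`, `G_∞ = GL_n(K_∞)` the archimedean group
of the datum `𝒟 = AutomorphyDatum.gl n K hcpt`, `π = W / W'` an automorphic representation of
`GL_n(𝔸_K)` (`W` a space of automorphic FUNCTIONS), `σS = E_λ(ℂ) ⊗ ε_S` the sign-twisted archimedean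
coefficient representation of `G_∞` (`ConeDictionary.σS`), and `η` a `(q+1)`-cochain of the
`(𝔤, K_∞)`-complex `ConeDictionary.gkComplexLS π S λ`.  The Borel–Wallach dictionary attaches to `η`
and a finite-adelic point `c` the `E`-valued `(q+1)`-form `ω_c = ConeDictionary.coneForm π S λ η c` on
the hermitian space `ResGLnCone.hermSpace n K`:
`ω_c(H)(v₁, …) = σS(g) · η(½ g⁻¹ v₁ g⁻ᴴ, …)(g, c)` for any `g ∈ G_∞` with `g gᴴ = H`.  For EVERY
`γ ∈ GL_n(K)` (not only totally positive ones), acting on `H` by `γ • H = γ_∞ H γ_∞ᴴ`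
(`ResGLnCone.coneActionRat`, `γ_∞ = GL_n(ι_∞)(γ) = ParallelWeight.diagArch K n γ`), on `c` by
`γ_f = BigHeckeGLn.globalEmbedding n K γ` and on `E` by `σS(γ_∞)`, the family is EQUIVARIANT on the
positive cone:  `ω_{γ_f c}(γ • H)(γ • v₁, …) = σS(γ_∞) ω_c(H)(v₁, …)`.

Proof [BorelWallach2000, VII 2.2–2.4] (left `G(ℚ)`-equivariance of the de Rham dictionary), verbatim
the proof of the totally positive case `stub_coneForm_equivariant` WITHOUT the final identification
`σS(γ_∞) = E_λ(γ)` (which needs total positivity).  Pick `g ∈ G_∞` with `g gᴴ = H` (transitivity of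
the cone model, `stub_coneModel`); then `γ • H = (γ_∞ g)(γ_∞ g)ᴴ`, and by the independence of the
section (`ConeDictionary.coneForm_eq_of_mul_conjTranspose_eq`) both sides are left-trivialised forms,
at `γ_∞ g` and at `g`.  The trivialised tangent vectors agree,
`(γ_∞ g)⁻¹ · ½ (γ_∞ v γ_∞ᴴ) (γ_∞ g)⁻ᴴ = g⁻¹ · ½ v g⁻ᴴ`, so both sides evaluate `η` at the SAME element
of `∧^{q+1} 𝔤`; the adelic points are related by `(γ_∞ g, γ_f c) = γ_𝔸 · (g, c)` in `GL_n(𝔸_K)`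
(`γ_𝔸 = (γ_∞, 1)(1, γ_f)`, `HumbertForm.map_algebraMap_eq_ofInfinite_mul_ofFinite`, and `g_∞` commutes
with `γ_f`), every `ψ ∈ W` is left `GL_n(K)`-invariant (`evalTensor_toAdelic_mul`), and finally
`σS(γ_∞ g) = σS(γ_∞) σS(g)`.
-/

set_option linter.dupNamespace false -- project-wide: `Summit.Langlands.Langlands` is the mandated namespace

noncomputable section

open scoped Matrix TensorProduct Classical
open NumberField NumberField.mixedEmbedding
open Literature.NumberTheory.Automorphic

namespace Summit.Langlands.Langlands.Theorems.HeckeEigenvalueField.Res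

open ResGLnCohomology BigHeckeGLn

section Helpers

variable {n : ℕ} {K : Type} [Field K] [NumberField K]

/-- **The adelic points are related by `γ_𝔸`**, for every `γ ∈ GL_n(K)`:
`(γ_∞ g, γ_f c) = γ_𝔸 · (g, c)` in `GL_n(𝔸_K)` with `γ_f = globalEmbedding γ` and `d = γ_∞` over the
datum (`γ_𝔸 = (γ_∞, 1)(1, γ_f)` and `g_∞`, `γ_f` commute). [cite: BorelWallach2000, VII 2.2–2.4] -/
theorem adelicPt_mul_globalEmbedding_mul {hcpt : isCompact_glFiniteIntegralLevel n K} (γ : GL (Fin n) K)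
    (d g₁ : (AutomorphyDatum.gl n K hcpt).arch.carrier)
    (hofd : (AutomorphyDatum.gl n K hcpt).ofArch d = GLn.ofInfinite n K (HumbertForm.ratToMixed K n γ))
    (c : FiniteAdelicGL n K) :
    ConeDictionary.adelicPt hcpt (d * g₁) (BigHeckeGLn.globalEmbedding n K γ * c) =
      (AdelicGroupData.gl n K).toAdelic γ * ConeDictionary.adelicPt hcpt g₁ c := by
  -- `(d, γ_f) = γ_𝔸`: `γ_𝔸 = (γ_∞, 1) · (1, γ_f)`
  have hpt : ConeDictionary.adelicPt hcpt d (BigHeckeGLn.globalEmbedding n K γ) =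
      (AdelicGroupData.gl n K).toAdelic γ := by
    rw [ConeDictionary.adelicPt, hofd]
    exact (HumbertForm.map_algebraMap_eq_ofInfinite_mul_ofFinite γ).symm
  rw [ConeDictionary.adelicPt_mul_right, ConeDictionary.adelicPt_mul, hpt, mul_assoc]
  rfl

/-- **Equivariance of the left form under the full rational group**:
`σS(γ_∞ g) η(Y)(γ_∞ g, γ_f c) = σS(γ_∞) · (σS(g) η(Y)(g, c))` for `γ ∈ GL_n(K)`, `g ∈ G_∞` and any
arguments `Y` — automorphy of `W` under `γ_𝔸` and multiplicativity of `σS`; here `d ∈ G_∞` is `γ_∞`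
over the datum, given through its adelic face `hofd`. [cite: BorelWallach2000, VII 2.2–2.4] -/
theorem leftForm_mul_globalEmbedding_mul {hcpt : isCompact_glFiniteIntegralLevel n K}
    (π : AutomorphicRepData (AutomorphyDatum.gl n K hcpt))
    (S : Finset {w : InfinitePlace K // w.IsReal}) (lam : (K →+* ℂ) → Fin n → ℤ) {q : ℕ}
    (η : ConeDictionary.Cochain π lam q) (γ : GL (Fin n) K) (c : FiniteAdelicGL n K)
    (d g₁ : (AutomorphyDatum.gl n K hcpt).arch.carrier)
    (hofd : (AutomorphyDatum.gl n K hcpt).ofArch d = GLn.ofInfinite n K (HumbertForm.ratToMixed K n γ))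
    (Y : Fin q → Matrix (Fin n) (Fin n) (mixedSpace K)) :
    ConeDictionary.leftForm π S lam η (BigHeckeGLn.globalEmbedding n K γ * c)
        (((d * g₁ : (AutomorphyDatum.gl n K hcpt).arch.carrier) : GL (Fin n) (mixedSpace K)) :
          Matrix (Fin n) (Fin n) (mixedSpace K)) Y =
      ConeDictionary.σS hcpt S lam d (ConeDictionary.leftForm π S lam η c
        (((g₁ : (AutomorphyDatum.gl n K hcpt).arch.carrier) : GL (Fin n) (mixedSpace K)) :
          Matrix (Fin n) (Fin n) (mixedSpace K)) Y) := by
  rw [ConeDictionary.leftForm_apply, ConeDictionary.leftForm_apply, ConeDictionary.archOfMatrix_coe_datum,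
    ConeDictionary.archOfMatrix_coe_datum, ConeDictionary.leftFormAlg_apply, ConeDictionary.leftFormAlg_apply,
    ConeDictionary.twistedEval_apply, ConeDictionary.twistedEval_apply, map_mul (ConeDictionary.σS hcpt S lam) d g₁,
    Module.End.mul_apply, adelicPt_mul_globalEmbedding_mul γ d g₁ hofd c, evalTensor_toAdelic_mul]

end Helpers

/-- **Stub EQUIV-FULL — equivariance of the cone form under the full rational group `GL_n(K)` with the
sign-twisted archimedean coefficient action**: for every `γ ∈ GL_n(K)` (not only totally positive ones),
`ω_{γ_f c}(γ • H)(γ • v₁, …) = σS(γ_∞) ω_c(H)(v₁, …)` — the same proof as c8's `stub_coneForm_equivariant`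
(`leftForm_diag_mul` with the datum element `d = diagArch γ`, automorphy of `W` under `γ_𝔸`,
multiplicativity of `σS`, section independence `coneForm_eq_of_mul_conjTranspose_eq`), WITHOUT the
identification `σS(γ_∞) = E_λ(γ)` that needs total positivity. [cite: BorelWallach2000, VII 2.2–2.4] -/
theorem stub_coneForm_equivariant_full {n : ℕ} {K : Type} [Field K] [NumberField K]
    (hcpt : isCompact_glFiniteIntegralLevel n K) (π : AutomorphicRepData (AutomorphyDatum.gl n K hcpt))
    (S : Finset {w : InfinitePlace K // w.IsReal}) (lam : (K →+* ℂ) → Fin n → ℤ) {q : ℕ}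
    {η : ConeDictionary.Cochain π lam (q + 1)}
    (hη : η ∈ (ConeDictionary.gkComplexLS π S lam).carrier (q + 1))
    (γ : GL (Fin n) K) (c : BigHeckeGLn.FiniteAdelicGL n K) {H : ResGLnCone.hermSpace n K}
    (hH : H ∈ ResGLnCone.posCone n K) (v : Fin (q + 1) → ResGLnCone.hermSpace n K) :
    ConeDictionary.coneForm π S lam η (BigHeckeGLn.globalEmbedding n K γ * c)
        (ResGLnCone.coneActionRat n K γ H) (fun j => ResGLnCone.coneActionRat n K γ (v j)) =
      ConeDictionary.σS hcpt S lam (ParallelWeight.diagArch K n γ) (ConeDictionary.coneForm π S lam η c H v) := by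
  -- `γ_∞ = diagArch γ ∈ G_∞` over the datum, through its matrix face and its adelic face (both `rfl`)
  suffices key : ∀ d : (AutomorphyDatum.gl n K hcpt).arch.carrier,
      (d : GL (Fin n) (mixedSpace K)) = ResGLnCone.toMixedGL n K γ →
      (AutomorphyDatum.gl n K hcpt).ofArch d = GLn.ofInfinite n K (HumbertForm.ratToMixed K n γ) →
      ConeDictionary.coneForm π S lam η (BigHeckeGLn.globalEmbedding n K γ * c)
          (ResGLnCone.coneActionRat n K γ H) (fun j => ResGLnCone.coneActionRat n K γ (v j)) =
        ConeDictionary.σS hcpt S lam d (ConeDictionary.coneForm π S lam η c H v) from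
    key (ParallelWeight.diagArch K n γ) rfl rfl
  intro d hdU hofd
  -- a square root `g₁ ∈ G_∞` of `H` (transitivity of the cone model)
  obtain ⟨g₁, hg⟩ : ∃ g₁ : (AutomorphyDatum.gl n K hcpt).arch.carrier,
      (((g₁ : (AutomorphyDatum.gl n K hcpt).arch.carrier) : GL (Fin n) (mixedSpace K)) :
          Matrix (Fin n) (Fin n) (mixedSpace K)) *
        ((((g₁ : (AutomorphyDatum.gl n K hcpt).arch.carrier) : GL (Fin n) (mixedSpace K)) :
          Matrix (Fin n) (Fin n) (mixedSpace K)))ᴴ = (H : Matrix (Fin n) (Fin n) (mixedSpace K)) := by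
    obtain ⟨g, hg⟩ := (stub_coneModel n K).1 (H : Matrix (Fin n) (Fin n) (mixedSpace K)) hH.1 hH.2
    exact ⟨⟨g, Subgroup.mem_top _⟩, hg⟩
  -- `γ_∞ g₁` is a square root of `γ • H`
  have hg₂ : (((d * g₁ : (AutomorphyDatum.gl n K hcpt).arch.carrier) : GL (Fin n) (mixedSpace K)) :
          Matrix (Fin n) (Fin n) (mixedSpace K)) *
        ((((d * g₁ : (AutomorphyDatum.gl n K hcpt).arch.carrier) : GL (Fin n) (mixedSpace K)) :
          Matrix (Fin n) (Fin n) (mixedSpace K)))ᴴ =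
      ((ResGLnCone.coneActionRat n K γ H : ResGLnCone.hermSpace n K) :
        Matrix (Fin n) (Fin n) (mixedSpace K)) := by
    rw [ResGLnCone.coneActionRat_apply, ResGLnCone.coe_coneAction, ← hdU, ← hg, Subgroup.coe_mul, Units.val_mul,
      Matrix.conjTranspose_mul]
    simp only [Matrix.mul_assoc]
  -- section independence on both sides, equivariance of the left form
  rw [ConeDictionary.coneForm_eq_of_mul_conjTranspose_eq π S lam hη c g₁ hg,
    ConeDictionary.coneForm_eq_of_mul_conjTranspose_eq π S lam hη (BigHeckeGLn.globalEmbedding n K γ * c) (d * g₁) hg₂,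
    ContinuousAlternatingMap.compContinuousLinearMap_apply, ContinuousAlternatingMap.compContinuousLinearMap_apply,
    ConeDictionary.leftTrivForm_apply, ConeDictionary.leftTrivForm_apply,
    ← leftForm_mul_globalEmbedding_mul π S lam η γ c d g₁ hofd]
  -- the trivialised tangent vectors agree: `(γ_∞ g)⁻¹ · ½ (γ • vᵢ) (γ_∞ g)⁻ᴴ = g⁻¹ · ½ vᵢ g⁻ᴴ`
  congr 1
  funext i
  rw [Function.comp_apply, Function.comp_apply, ConeDictionary.halfRight_apply, ConeDictionary.halfRight_apply,
    ResGLnCone.coneActionRat_apply, ResGLnCone.coe_coneAction, ← hdU, Subgroup.coe_mul,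
    Ring.inverse_unit, Ring.inverse_unit, mul_inv_rev, Units.val_mul,
    Matrix.conjTranspose_mul, Matrix.mul_smul, Matrix.mul_smul]
  congr 1
  -- reassociation: for `ui um = 1`, `gi ui (um V umᴴ (uiᴴ giᴴ)) = gi (V giᴴ)`
  have key : ∀ (gi ui um V : Matrix (Fin n) (Fin n) (mixedSpace K)), ui * um = 1 →
      gi * ui * (um * V * umᴴ * (uiᴴ * giᴴ)) = gi * (V * giᴴ) := by
    intro gi ui um V h
    calc gi * ui * (um * V * umᴴ * (uiᴴ * giᴴ))
        = gi * (ui * um) * V * (ui * um)ᴴ * giᴴ := by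
          rw [Matrix.conjTranspose_mul]
          simp only [Matrix.mul_assoc]
      _ = gi * (V * giᴴ) := by
          rw [h, Matrix.conjTranspose_one, Matrix.mul_one, Matrix.mul_one, Matrix.mul_assoc]
  exact key _ _ _ _ (Units.inv_mul (d : GL (Fin n) (mixedSpace K)))

end Summit.Langlands.Langlands.Theorems.HeckeEigenvalueField.Res

end
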